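import Summits.Ventures.YMGap.Thresholds.SharpStrongCoupling
import Summits.Ventures.YMGap.Thresholds.SharpMassGap
import HarnessLib

/-!
# Venture YMGap — the strong-coupling phase statement and the unique infinite-volume limit at the
# sharp window from DLR UNIQUENESS alone (plumbing for the OBJECT-U capstone)

HONEST FRAMING: venture file (cell `pub-ymgap`, track (a), seat p2); bookkeeping, no new number. The
sibling file `SharpStrongCoupling.lean` derives Shen–Zhu–Zhu's strong-coupling PHASE statement
(`StrongCouplingPhaseAt`: torus states converge, translation invariance, unique free-boundary limit,
exponential decay of plaquette correlations) and the unique infinite-volume limit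
(`HasUniqueInfiniteVolumeLimit`) on the window 't Hooft `|β| < 1/(8d)` CONDITIONALLY on three named
facts (Bakry–Émery kernel LSI, Stroock–Zegarlinski, SZZ Cor. 4.11 transfer). The cell's OBJECT U
(pieces U1–U4, seats ds-2 / lit-1 / p2 / p1) proves DLR uniqueness `SharpUniqueness d N` at the sharp
window WITHOUT the first two facts, and brick L (seats lit-1 / ds-2) proves the transfer fact. This file
isolates the versions of the two statements that take exactly `SharpUniqueness d N` (and, for the phase
statement, the transfer fact `shenZhuZhu_massGap_transfer d N`) as hypotheses, so that the capstone
turns them into hypothesis-free theorems by two applications: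
`hasUniqueInfiniteVolumeLimit_sharp_of_uniqueness`, `strongCouplingPhase_sharp_of_uniqueness`,
`massGapAt_sharp_of_uniqueness`. WHAT IT IS NOT: nothing here is hypothesis-free by itself; nothing at
physical couplings; no area law.

Reference: H. Shen, R. Zhu, X. Zhu, CMP 400 (2023), Thm 1.2, Rem 1.3, Cor 1.6, Cor 4.11.
-/

noncomputable section

namespace Summit.Ventures.YMGap.HessianSharp

open MeasureTheory Filter Topology ProbabilityTheory
open Literature.MathematicalPhysics.QuantumFieldTheory
open Literature.MathematicalPhysics.QuantumLattice (LGConfig ymGibbsMeasures ymSpecification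
  fundamentalRep continuous_fundamentalRep)

variable {d N : ℕ}

/-- **Unique infinite-volume limit from DLR uniqueness at the sharp window**: if
`SharpUniqueness d N` holds, then for every 't Hooft `|β| < 1/(8d)` the torus `SU(N)` Wilson states
at tree coupling `Nβ` converge along the full sequence and the limit is the only infinite-volume
limit point. -/
theorem hasUniqueInfiniteVolumeLimit_sharp_of_uniqueness (hu : SharpUniqueness d N) {β : ℝ}
    (hβ : |β| < sharpThresholdSU d) :
    Literature.MathematicalPhysics.QuantumLattice.HasUniqueInfiniteVolumeLimit (d := d)
      (fundamentalRep (Fin N)) ((N : ℝ) * β) :=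
  hasUniqueInfiniteVolumeLimit_of_subsingleton' (hu β hβ).1

/-- **`MassGapAt` at one sharp coupling from uniqueness and the transfer fact** (pointwise form of
`massGapBelow_sharp_of_uniqueness`). -/
theorem massGapAt_sharp_of_uniqueness (h : shenZhuZhu_massGap_transfer d N) (hu : SharpUniqueness d N)
    (hd : 2 ≤ d) (hN : 2 ≤ N) {β : ℝ} (hβ : |β| < sharpThresholdSU d) : MassGapAt d N β :=
  massGapBelow_sharp_of_uniqueness h hu hd hN β hβ

/-- **The strong-coupling phase statement on `|β_tree| < N/(8d)` from uniqueness and the transfer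
fact**: for `d, N ≥ 2`, DLR uniqueness at the sharp window (`SharpUniqueness d N`) and SZZ's Cor. 4.11
transfer give, for every tree coupling `|β| < N/(8d)` ('t Hooft `|β/N| < 1/(8d)`), convergence of the
periodic `SU(N)` Wilson states to a translation-invariant `μ`, identification of every free-boundary
limit with `μ`, and exponential decay of plaquette correlations under `μ` (`StrongCouplingPhaseAt`). -/
theorem strongCouplingPhase_sharp_of_uniqueness (h : shenZhuZhu_massGap_transfer d N)
    (hu : SharpUniqueness d N) (hN : 2 ≤ N) (hd : 2 ≤ d) {β : ℝ} (hβ : |β| < N / (8 * d)) :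
    StrongCouplingPhaseAt d N β :=
  strongCouplingPhaseAt_of_massGapAt hN hd
    (massGapAt_sharp_of_uniqueness h hu hd hN (abs_div_lt_sharpThreshold (le_trans one_le_two hN) hβ))

end Summit.Ventures.YMGap.HessianSharp
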